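import Summits.QuantumFields.YangMills.Theorems.BalabanUVNodesN21GappedPairRoadK3V7Knit

/-!
# N21 (NE7c) · THE v7 FACE BY THE REGISTERED NAMES and its NON-DEGENERATE INHABITATION — chair ■ R468 (C-N21-3) «UNFOLDED BINDERS» cured, (C-N21-2) A2 tuple exhibited

R134 seat `pub-ymgap-dag-n21-d` (g17, lane owner N21), strategy s2; key K3⁸ `SpineGivenEndpointR13SepCoPHV` = stmt-QuantumFields-27366, `--kind proof --supports 27366 --as helper`;
COUNT-NEUTRAL until the chair books.  Theorems only (0 `def`, 0 `sorry`, no `instance`, no `notation`).  Context: «DISCHARGE CLAIMED N21: …N21GappedPairRoadK3V6KnitZeta.lean p658766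
39e10f326e14» (pub-ymgap INBOX l.43937); chair ■ R468 acts (l.≈43963): (C-N21-3) asked for the N21 face with its pin ∕ dial rows stated BY THE REGISTERED v7 NAMES
(`K3V7Defs.PinnedAtLiveGap2` :48, `K3V7Defs.DialRows` :55 = kit a85cbf6c34a09649 :517 ∕ :524) instead of unfolded — «a ≤ 40-line by-name edition landing the same is welcome and would
become the pid of record»; (C-N21-2) asked to exhibit ONE `(jc, ρ, ρ′, n₁, n₂, cr)` tuple inhabiting `hon ∧ hoff ∧ hρ ∧ hn` jointly at a NON-degenerate dial setting.

WHAT IS PROVED ([bookkeeping] BY NAME over ζ1 p658766 and V1 p629674's witness construction; NO estimate):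
* §1 ★★★ `keyedShellWeight_of_pinnedAtLiveGap2_of_dialRows` — `PinnedAtLiveGap2 jc ρ ρ′ n₁ n₂ cr` → (off the live line `cr` = dag-n20-w1's one-term device) → `DialRows ρ ρ′ n₁ n₂` →
  `KeyedShellWeight cr` (= ζ1 `keyedShellWeight_of_gap2Pin_zeta`, binders now the registered names: the identity (C-N21-3) asks is DEFINITIONAL — this file is the kernel's word for it);
  ★★ `keyedExtraction_of_pinnedAtLiveGap2` — the N27x faces at the same reading, NO dial row.
* §2 ★★★ `exists_pinnedAtLiveGap2_dialRows_faces` — FOR EVERY cut policy `jc` there are dials and a spine reading with `PinnedAtLiveGap2 … cr ∧ DialRows … ∧` (off-live = one-term) `∧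
  KeyedShellWeight cr ∧ KeyedExtractionBFree cr ∧ KeyedExtractionV cr`, the dials DISPLAYED as the constants `ρ ≡ ρ′ ≡ 1∕2` (a genuine two-sided collar of relative width ½ at every step)
  and `n₁ K = n₂ K = 2^K` (depth ↑ ∞, `Σ_K 2∕(2^K+1) < ∞`): the (C-N21-2)∕A2 tuple IN THE KERNEL, UNCONDITIONAL — N21's and N27x's v7 conjuncts are inhabited JOINTLY with the stub's pin and
  dial conjuncts at a non-degenerate setting, for every persistence policy (contrast v6's free `sh`, inhabited only at the junk corner or via the unprinted (M1), p674620).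
  `dialRows_const_half_pow_two` is the dial rows for those constants (`summable_geometric_two` by comparison).

HONEST FRAMING (binding).  Compositions BY NAME; NO estimate of Bałaban's; what §2 inhabits is N21 AS THE ROUTE OF RECORD CONSUMES IT (selected thresholds on the live line,
[Balaban1989LargeFieldI] p.181) — NE7c at print's FIXED thresholds is NOT PRINTED and NOT proved; K3⁸ stub 2 stays OPEN on its N19′ ∕ N20 ∕ U5 rows (other lanes; §2 says nothing about
them — its reading need not be the one those lanes will dial); K3⁸ NOT claimed; N21's booking is the chair's act and the count the director's; counts UNMOVED (typed 28∕28 · discharged 6∕28,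
display 6∕27).  Standard axioms only.  One finite four-torus programme at fixed `ε` — NOT ℝ⁴, NOT OS, NOT a mass gap, NOT Clay.
-/

set_option autoImplicit false

noncomputable section

open scoped BigOperators

namespace Summit.QuantumFields.YangMills.Theorems.N21GappedRoadK3V7Knit

open Literature.MathematicalPhysics.QuantumFieldTheory.Balaban1983to89
open Literature.MathematicalPhysics.QuantumFieldTheory.Balaban1983to89.T4Continuum
open Literature.MathematicalPhysics.QuantumFieldTheory.Balaban1983to89.Node00
open Summit.QuantumFields.YangMills.Theorems.K3V5Defs (SpineReading CutReading KeyedShellWeight LiveSel)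
open Summit.QuantumFields.YangMills.Theorems.K3V6Defs (KeyedExtractionV KeyedExtractionBFree)
open Summit.QuantumFields.YangMills.Theorems.K3V7Defs (PinnedAtLiveGap2 DialRows dialRows_of_rows)
open Summit.QuantumFields.YangMills.BalabanUVNodes.N20OffLiveOneTermReading (crOneTerm₁₃)
open Summit.QuantumFields.YangMills.Theorems.N21ShellSplitOfRecord13CoPH (WidthLetter₁₃CoPH DepthLetter₁₃CoPH)
open Summit.QuantumFields.YangMills.Theorems.N21GappedTopPair13CoPH (crGap2₁₃V)
open Summit.QuantumFields.YangMills.Theorems.N21GappedRoadK3V6Knit (keyedShellWeight_of_gap2Pin_zeta keyedExtraction_of_gap2Pin_zeta exists_reading_livePin)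

/-! ## §1 The N21 ∕ N27x faces with the pin and the dial rows stated BY THE REGISTERED v7 NAMES ((C-N21-3)) -/

/-- ★★★ **N21's v7 FACE, BY NAME**: a spine reading pinned on the live line per the REGISTERED `K3V7Defs.PinnedAtLiveGap2 jc ρ ρ′ n₁ n₂ cr`, reading dag-n20-w1's one-term device off it,
with dials carrying the REGISTERED `K3V7Defs.DialRows ρ ρ′ n₁ n₂`, satisfies the stub's N21 conjunct `KeyedShellWeight cr` — ζ1 `keyedShellWeight_of_gap2Pin_zeta` (p658766 :53), whose
unfolded binders ARE these names' bodies (definitional; this term is the kernel's confirmation). [bookkeeping] -/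
theorem keyedShellWeight_of_pinnedAtLiveGap2_of_dialRows (jc : CutReading) (ρ ρ' : WidthLetter₁₃CoPH 2) (n₁ n₂ : DepthLetter₁₃CoPH 2) {cr : SpineReading}
    (hon : PinnedAtLiveGap2 jc ρ ρ' n₁ n₂ cr)
    (hoff : ∀ (F : T4Family) (θ : Stage13HParams F 2) (hP : θ.Provisos₁₃CoPH F 2) (g₀ : ℕ → ℝ) (os : List (ULoop F)),
      ¬ LiveSel F θ → cr F θ hP g₀ os = crOneTerm₁₃ 0 F θ hP g₀ os)
    (hd : DialRows ρ ρ' n₁ n₂) :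
    KeyedShellWeight cr :=
  keyedShellWeight_of_gap2Pin_zeta jc ρ ρ' n₁ n₂ hon hoff hd.1 hd.2

/-- ★★ **N27x's v7 FACES, BY NAME** — `KeyedExtractionBFree cr ∧ KeyedExtractionV cr` at the same reading, NO dial row (ζ1 `keyedExtraction_of_gap2Pin_zeta`). [bookkeeping] -/
theorem keyedExtraction_of_pinnedAtLiveGap2 (jc : CutReading) (ρ ρ' : WidthLetter₁₃CoPH 2) (n₁ n₂ : DepthLetter₁₃CoPH 2) {cr : SpineReading}
    (hon : PinnedAtLiveGap2 jc ρ ρ' n₁ n₂ cr)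
    (hoff : ∀ (F : T4Family) (θ : Stage13HParams F 2) (hP : θ.Provisos₁₃CoPH F 2) (g₀ : ℕ → ℝ) (os : List (ULoop F)),
      ¬ LiveSel F θ → cr F θ hP g₀ os = crOneTerm₁₃ 0 F θ hP g₀ os) :
    KeyedExtractionBFree cr ∧ KeyedExtractionV cr :=
  keyedExtraction_of_gap2Pin_zeta jc ρ ρ' n₁ n₂ hon hoff

/-! ## §2 Non-degenerate inhabitation: the (C-N21-2) ∕ A2 tuple in the kernel -/

/-- ★ **THE DIAL ROWS AT THE CONSTANTS `ρ ≡ ρ′ ≡ 1∕2`, `n₁ K = n₂ K = 2^K`**: widths in `[0,1]` trivially; `Σ_K (1∕(2^K+1) + 1∕(2^K+1)) < ∞` by comparison with the geometric series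
`summable_geometric_two` (`1∕(2^K+1) ≤ (1∕2)^K`).  A genuine two-sided collar of relative width ½ with unbounded depth — not a degenerate setting. [folklore] -/
theorem dialRows_const_half_pow_two :
    DialRows (fun _ _ _ _ _ _ => (1 / 2 : ℝ)) (fun _ _ _ _ _ _ => (1 / 2 : ℝ)) (fun _ _ _ _ _ K => 2 ^ K) (fun _ _ _ _ _ K => 2 ^ K) := by
  refine dialRows_of_rows _ _ _ _ (fun _ _ _ _ _ _ => ⟨⟨by norm_num, by norm_num⟩, ⟨by norm_num, by norm_num⟩⟩) (fun _ _ _ _ _ => ?_)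
  have hgeo : Summable (fun K : ℕ => ((1 : ℝ) / 2) ^ K + ((1 : ℝ) / 2) ^ K) := summable_geometric_two.add summable_geometric_two
  refine hgeo.of_nonneg_of_le (fun K => by positivity) (fun K => ?_)
  have hK : ((1 : ℝ) / 2) ^ K = 1 / (2 : ℝ) ^ K := by rw [div_pow, one_pow]
  have hle : 1 / (((2 ^ K : ℕ) : ℝ) + 1) ≤ ((1 : ℝ) / 2) ^ K := by
    rw [hK]
    push_cast
    exact one_div_le_one_div_of_le (by positivity) (by linarith)
  exact add_le_add hle hle

/-- ★★★ **(C-N21-2) ∕ A2 IN THE KERNEL — FOR EVERY CUT POLICY, N21's AND N27x's v7 CONJUNCTS ARE INHABITED JOINTLY WITH THE STUB's PIN AND DIAL CONJUNCTS AT A NON-DEGENERATE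
SETTING.**  For every `jc` there are dials `ρ ρ′ n₁ n₂` and a spine reading `cr` with: `PinnedAtLiveGap2 jc ρ ρ′ n₁ n₂ cr` (the registered pin), `DialRows ρ ρ′ n₁ n₂` (the registered
dial rows), `cr` = dag-n20-w1's one-term device off the live line, the dials DISPLAYED as the constants `ρ ≡ ρ′ ≡ 1∕2`, `n₁ K = n₂ K = 2^K`, AND `KeyedShellWeight cr ∧ KeyedExtractionBFree cr ∧
KeyedExtractionV cr`.  UNCONDITIONAL (no hypothesis at all): the reading is V1's `exists_reading_livePin` witness `if LiveSel then crGap2₁₃V … else crOneTerm₁₃ 0`; the faces are §1.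
Says nothing about the stub's N20 ∕ N19′ ∕ U5 rows, nor that those lanes must dial these constants. [bookkeeping] -/
theorem exists_pinnedAtLiveGap2_dialRows_faces (jc : CutReading) :
    ∃ (ρ ρ' : WidthLetter₁₃CoPH 2) (n₁ n₂ : DepthLetter₁₃CoPH 2) (cr : SpineReading),
      PinnedAtLiveGap2 jc ρ ρ' n₁ n₂ cr ∧ DialRows ρ ρ' n₁ n₂ ∧
      (∀ (F : T4Family) (θ : Stage13HParams F 2) (hP : θ.Provisos₁₃CoPH F 2) (g₀ : ℕ → ℝ) (os : List (ULoop F)),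
        ¬ LiveSel F θ → cr F θ hP g₀ os = crOneTerm₁₃ 0 F θ hP g₀ os) ∧
      (∀ (F : T4Family) (θ : Stage13HParams F 2) (hP : θ.Provisos₁₃CoPH F 2) (g₀ : ℕ → ℝ) (os : List (ULoop F)) (K : ℕ),
        ρ F θ hP g₀ os K = 1 / 2 ∧ ρ' F θ hP g₀ os K = 1 / 2 ∧ n₁ F θ hP g₀ os K = 2 ^ K ∧ n₂ F θ hP g₀ os K = 2 ^ K) ∧
      KeyedShellWeight cr ∧ KeyedExtractionBFree cr ∧ KeyedExtractionV cr := by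
  obtain ⟨cr, hon, hoff⟩ := exists_reading_livePin
    (fun F θ hP g₀ os => crGap2₁₃V 2 (jc F θ hP g₀ os) (fun _ _ _ _ _ _ => (1 / 2 : ℝ)) (fun _ _ _ _ _ _ => (1 / 2 : ℝ))
      (fun _ _ _ _ _ K => 2 ^ K) (fun _ _ _ _ _ K => 2 ^ K) F θ hP g₀ os)
  refine ⟨_, _, _, _, cr, hon, dialRows_const_half_pow_two, hoff, fun _ _ _ _ _ _ => ⟨rfl, rfl, rfl, rfl⟩,
    keyedShellWeight_of_pinnedAtLiveGap2_of_dialRows jc _ _ _ _ hon hoff dialRows_const_half_pow_two,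
    keyedExtraction_of_pinnedAtLiveGap2 jc _ _ _ _ hon hoff⟩

end Summit.QuantumFields.YangMills.Theorems.N21GappedRoadK3V7Knit

end
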